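import Literature.Computability.MetaComplexity.DLOResLinTreeLike
import HarnessLib

/-!
# The ceiling of the extensibility method for `DLO_n`: not `(⌊n/2⌋ + 1)`-extensible w.r.t. `WORDER_n`

Companion of `DLOResLinTreeLike.lean` (Gryaznov–Ovcharov–Riazanov 2024, Lemma 4: `DLO_n` is
`(⌊(n−3)/3⌋ + 1)`-extensible w.r.t. `WORDER_n`, `isExtensible_dloCNF`) and `DLOTreeLikeBounds.lean`
(their Theorem 5). The lower bounds obtained through GOR's Theorems 1–2 (`ResLinExtensible.lean`)
are exactly as good as the extensibility parameter, so it is natural to ask how far that parameter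
can go. For the ordering principle the answer is exact (`not_isExtensible_orderingCNF`: `n − 1` and
not `n`). For `DLO_n` this file gives the upper side of a window:

* `not_isExtensible_dloCNF`: for `n ≥ 3`, `DLO_n` is NOT `(⌊n/2⌋ + 1)`-extensible w.r.t. `WORDER_n`.
  Witness: the `⌊n/2⌋` equations `z_{a, a+1, 0} = 1` for the pairs `(a, a+1) = (2,3), (4,5), …`
  below `n` together with `x_{01} = 1` (`n` even) resp. `z_{n−1, 0, 1} = 1` (`n` odd). They have a
  `WORDER_n`-proper solution (the order `2 ≺ 3 ≺ ⋯ ≺ n−1 ≺ 0 ≺ 1` with exactly these witnesses), and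
  in EVERY `WORDER_n`-proper solution the witness clauses force `0 ≺ 1` and place every other
  element below `0` (directly, or through its partner and transitivity), so no `k` can witness
  `0 ≺ k ≺ 1`: the density clause `D_{01}` fails.
* `dloCNF_extensibility_window`: the two sides together,
  `IsExtensible (dloCNF n) (worderClauses n) ((n−3)/3 + 1) ∧ ¬ IsExtensible (dloCNF n) (worderClauses n) (n/2 + 1)`.

So GOR's Theorems 1–2 with `F = WORDER_n` certify tree-like Res(⊕) size `≥ 2^{⌊(n−3)/3⌋+1}` for
`DLO_n` and cannot certify more than `2^{⌊n/2⌋}`; where in `[n/3, n/2]` the true parameter lies is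
left open here. (Not in print; the printed Lemma 4 / Theorem 5 are unaffected.)

## References

* S. Gryaznov, S. Ovcharov, A. Riazanov, *Resolution over linear equations: combinatorial games for
  tree-like size and space*, ACM Trans. Comput. Theory 16(3) (2024) = arXiv:2404.08370, §3.1.3,
  Lemma 4, Theorem 5 [GryaznovOvcharovRiazanov2024].
* S. Gryaznov, CSR 2019, LNCS 11532, §3.3 [Gryaznov2019].
-/

namespace Literature.Computability.MetaComplexity

open _root_.Computability Complexity Finset OrderParity

/-- A single-variable equation `x_v = 1` holds at `τ` iff `τ v = true`. [folklore] -/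
private theorem linLit_eval_singleton_true (τ : ℕ → Bool) (v : ℕ) :
    LinLit.eval τ (({v} : Finset ℕ), true) = τ v := by
  have := eval_toLinLit (v, true) τ
  simpa [Literal.toLinLit, Literal.eval] using this

/-- **The ceiling of the extensibility method for `DLO_n`.** For `n ≥ 3`, `DLO_n` is not
`(⌊n/2⌋ + 1)`-extensible w.r.t. `WORDER_n`: the `⌊n/2⌋` equations `z_{a,a+1,0} = 1` (`a = 2, 4, …`,
`a + 1 < n`) and `x_{01} = 1` (`n` even) / `z_{n−1,0,1} = 1` (`n` odd) have a `WORDER_n`-proper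
solution, and every `WORDER_n`-proper solution of them falsifies the density clause `D_{01}`.
Hence GOR's Theorems 1–2 with `F = WORDER_n` cannot certify tree-like Res(⊕) size above `2^{⌊n/2⌋}`
(nor clause space above `⌊n/2⌋`) for `DLO_n`. [Gryaznov–Ovcharov–Riazanov 2024, §3.1.3 (the
method); the statement is not in print] [folklore] -/
theorem not_isExtensible_dloCNF {n : ℕ} (hn : 3 ≤ n) :
    ¬ IsExtensible (dloCNF n) (worderClauses n) (n / 2 + 1) := by
  classical
  obtain ⟨N, rfl⟩ := Nat.exists_eq_add_of_le' hn
  intro hext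
  -- the system: pairs below `0`, and `0 ≺ 1`
  set m : ℕ := (N + 1) / 2 with hm
  set P : List LinLit := (List.range m).map fun j =>
    (({zVar (N + 3) (2 * j + 2, 2 * j + 3, 0)} : Finset ℕ), true) with hP
  set E : LinLit := if (N + 3) % 2 = 0 then (({ordVar (N + 3) 0 1} : Finset ℕ), true)
    else (({zVar (N + 3) (N + 2, 0, 1)} : Finset ℕ), true) with hE
  set Φ : List LinLit := E :: P with hΦ
  have hlen : Φ.length < (N + 3) / 2 + 1 := by
    rw [hΦ, List.length_cons, hP, List.length_map, List.length_range, hm]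
    omega
  have hmemP : ∀ e, e ∈ P ↔
      ∃ j, j < m ∧ e = (({zVar (N + 3) (2 * j + 2, 2 * j + 3, 0)} : Finset ℕ), true) := by
    intro e
    simp only [hP, List.mem_map, List.mem_range]
    constructor
    · rintro ⟨j, hj, rfl⟩; exact ⟨j, hj, rfl⟩
    · rintro ⟨j, hj, rfl⟩; exact ⟨j, hj, rfl⟩
  have hpair : ∀ j, j < m → (2 * j + 2, 2 * j + 3, 0) ∈ distinctTriples (N + 3) := by
    intro j hj
    rw [mem_distinctTriples]
    dsimp only
    omega
  have hlast : (N + 2, 0, 1) ∈ distinctTriples (N + 3) := by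
    rw [mem_distinctTriples]
    dsimp only
    omega
  -- a proper solution: the order `2 ≺ 3 ≺ ⋯ ≺ N+2 ≺ 0 ≺ 1` with the system's witnesses
  set ρ : ℕ → ℕ := fun k => if k = 0 then N + 3 else if k = 1 then N + 4 else k with hρ
  set W : Finset (ℕ × ℕ × ℕ) := ((Finset.range m).image fun j => (2 * j + 2, 2 * j + 3, 0)) ∪
    (if (N + 3) % 2 = 0 then ∅ else {(N + 2, 0, 1)}) with hW
  have hρ0 : ρ 0 = N + 3 := by simp [hρ]
  have hρ1 : ρ 1 = N + 4 := by simp [hρ]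
  have hρk : ∀ k, 2 ≤ k → ρ k = k := by
    intro k hk
    simp only [hρ]
    split_ifs <;> omega
  have hρinj : Set.InjOn ρ (Finset.range (N + 3) : Finset ℕ) := by
    intro a ha b hb hab
    simp only [Finset.coe_range, Set.mem_Iio] at ha hb
    simp only [hρ] at hab
    split_ifs at hab <;> omega
  have hWproper : WProper (Finset.range (N + 3)) ρ W := by
    intro τ hτ
    rw [hW, Finset.mem_union, Finset.mem_image] at hτ
    rcases hτ with ⟨j, hj, rfl⟩ | hτ
    · rw [Finset.mem_range] at hj
      dsimp only
      rw [hρ0, hρk _ (by omega), hρk _ (by omega)]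
      exact ⟨⟨Finset.mem_range.2 (by omega), Finset.mem_range.2 (by omega),
        Finset.mem_range.2 (by omega)⟩, by omega, by omega⟩
    · split_ifs at hτ with hpar
      · exact absurd hτ (Finset.notMem_empty _)
      · rw [Finset.mem_singleton] at hτ
        subst hτ
        dsimp only
        rw [hρ0, hρ1, hρk _ (by omega)]
        exact ⟨⟨Finset.mem_range.2 (by omega), Finset.mem_range.2 (by omega),
          Finset.mem_range.2 (by omega)⟩, by omega, by omega⟩
  set σ₀ : ℕ → Bool := dloAssign (N + 3) ρ W fun _ => false with hσ₀
  have hσ₀F : IsFProper (worderClauses (N + 3)) σ₀ := isFProper_dloAssign hρinj hWproper _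
  have hmemW_pair : ∀ j, j < m → (2 * j + 2, 2 * j + 3, 0) ∈ W := fun j hj => by
    rw [hW, Finset.mem_union, Finset.mem_image]
    exact Or.inl ⟨j, Finset.mem_range.2 hj, rfl⟩
  have hσ₀Φ : ∀ e ∈ Φ, LinLit.eval σ₀ e = true := by
    intro e he
    rw [hΦ, List.mem_cons] at he
    rcases he with rfl | he
    · rw [hE]
      split_ifs with hpar
      · rw [linLit_eval_singleton_true, hσ₀,
          dloAssign_ordVar ρ W _ (by omega) (by omega) (by omega), hρ0, hρ1, decide_eq_true_eq]
        omega
      · rw [linLit_eval_singleton_true, hσ₀, dloAssign_zVar ρ W _ hlast, decide_eq_true_eq, hW,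
          Finset.mem_union]
        refine Or.inr ?_
        rw [if_neg hpar, Finset.mem_singleton]
    · obtain ⟨j, hj, rfl⟩ := (hmemP e).1 he
      rw [linLit_eval_singleton_true, hσ₀, dloAssign_zVar ρ W _ (hpair j hj), decide_eq_true_eq]
      exact hmemW_pair j hj
  -- the density clause `D_{01}` is a clause of `DLO` outside `WORDER` (false under the proper `σ₀`)
  have hc : densityClause (N + 3) 0 1 ∈ dloCNF (N + 3) :=
    densityClause_mem_dloCNF (by omega) (by omega) (by omega)
  have hσ₀c : Clause.eval σ₀ (densityClause (N + 3) 0 1) = false := by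
    by_contra h
    rw [Bool.not_eq_false, eval_densityClause_iff] at h
    rcases h with h | ⟨k, hk, hk0, hk1, hz⟩
    · rw [hσ₀, dloAssign_ordVar ρ W _ (by omega) (by omega) (by omega), hρ0, hρ1,
        decide_eq_false_iff_not] at h
      exact h (by omega)
    · have hτk : (0, k, 1) ∈ distinctTriples (N + 3) := by
        rw [mem_distinctTriples]
        dsimp only
        omega
      rw [hσ₀, dloAssign_zVar ρ W _ hτk, decide_eq_true_eq, hW, Finset.mem_union,
        Finset.mem_image] at hz
      rcases hz with ⟨j, -, hj⟩ | hz
      · have := congrArg Prod.fst hj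
        dsimp only at this
        omega
      · split_ifs at hz
        · exact Finset.notMem_empty _ hz
        · rw [Finset.mem_singleton] at hz
          have := congrArg Prod.fst hz
          dsimp only at this
          omega
  have hcF : densityClause (N + 3) 0 1 ∉ worderClauses (N + 3) := fun h => by
    have := hσ₀F _ h
    rw [hσ₀c] at this
    exact Bool.noConfusion this
  -- extensibility would give a proper solution of the system satisfying `D_{01}`
  obtain ⟨τ, hτF, hτΦ, hτc⟩ := hext Φ hlen ⟨σ₀, hσ₀F, hσ₀Φ⟩ _ hc hcF
  obtain ⟨hanti, -, htrans⟩ :=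
    isFProper_linOrderClauses_iff.1 (isFProper_worderClauses_iff.1 hτF).1
  have hwitness := (isFProper_worderClauses_iff.1 hτF).2
  -- `0 ≺ 1` under `τ`
  have hE' : LinLit.eval τ E = true := hτΦ E (by rw [hΦ]; exact List.mem_cons_self)
  have h01 : τ (ordVar (N + 3) 0 1) = true := by
    rw [hE] at hE'
    split_ifs at hE' with hpar
    · rwa [linLit_eval_singleton_true] at hE'
    · rw [linLit_eval_singleton_true] at hE'
      exact (hwitness _ hlast hE').2
  -- every pair equation holds under `τ`
  have hPτ : ∀ j, j < m → τ (zVar (N + 3) (2 * j + 2, 2 * j + 3, 0)) = true := by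
    intro j hj
    have := hτΦ _ (by rw [hΦ]; exact List.mem_cons_of_mem _ ((hmemP _).2 ⟨j, hj, rfl⟩))
    rwa [linLit_eval_singleton_true] at this
  -- a witness `k` for `D_{01}`
  rcases eval_densityClause_iff.1 hτc with h | ⟨k, hk, hk0, hk1, hzk⟩
  · rw [h01] at h
    exact Bool.noConfusion h
  have hτk : (0, k, 1) ∈ distinctTriples (N + 3) := by
    rw [mem_distinctTriples]
    dsimp only
    omega
  obtain ⟨h0k, -⟩ := hwitness _ hτk hzk
  dsimp only at h0k
  -- `k` is placed below `0` by the system: contradiction with `x_{0k} = 1`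
  by_cases hkl : k = N + 2 ∧ (N + 3) % 2 = 1
  · -- the odd leftover element
    obtain ⟨rfl, hpar⟩ := hkl
    have hz : τ (zVar (N + 3) (N + 2, 0, 1)) = true := by
      rw [hE, if_neg (by omega), linLit_eval_singleton_true] at hE'
      exact hE'
    have hk0' := (hwitness _ hlast hz).1
    dsimp only at hk0'
    exact hanti 0 (N + 2) (by omega) (by omega) (by omega) ⟨h0k, hk0'⟩
  · -- `k` lies in the pair with index `j = (k - 2) / 2`
    set j := (k - 2) / 2 with hj
    have hjm : j < m := by
      rw [hj, hm]
      omega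
    have hz := hPτ j hjm
    obtain ⟨hab, hb0⟩ := hwitness _ (hpair j hjm) hz
    dsimp only at hab hb0
    rcases Nat.even_or_odd k with ⟨b, hb⟩ | ⟨b, hb⟩
    · -- `k = 2j + 2`: `k ≺ k+1 ≺ 0` and `0 ≺ k`
      have hk2 : 2 * j + 2 = k := by omega
      have hk3 : 2 * j + 3 = k + 1 := by omega
      rw [hk2, hk3] at hab
      rw [hk3] at hb0
      have hk0' : τ (ordVar (N + 3) k 0) = true :=
        htrans k (k + 1) 0 hk (by omega) (by omega) (by omega) hk0 (by omega) hab hb0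
      exact hanti 0 k (by omega) hk (Ne.symm hk0) ⟨h0k, hk0'⟩
    · -- `k = 2j + 3`: `k ≺ 0` and `0 ≺ k`
      have hk3 : 2 * j + 3 = k := by omega
      rw [hk3] at hb0
      exact hanti 0 k (by omega) hk (Ne.symm hk0) ⟨h0k, hb0⟩

/-- **The extensibility window of `DLO_n` w.r.t. `WORDER_n`** (`n ≥ 3`): at least `⌊(n−3)/3⌋ + 1`
(GOR Lemma 4, `isExtensible_dloCNF`) and at most `⌊n/2⌋` (`not_isExtensible_dloCNF`).
[Gryaznov–Ovcharov–Riazanov 2024, Lemma 4; the upper side is not in print] [folklore] -/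
theorem dloCNF_extensibility_window {n : ℕ} (hn : 3 ≤ n) :
    IsExtensible (dloCNF n) (worderClauses n) ((n - 3) / 3 + 1) ∧
      ¬ IsExtensible (dloCNF n) (worderClauses n) (n / 2 + 1) :=
  ⟨isExtensible_dloCNF n, not_isExtensible_dloCNF hn⟩

end Literature.Computability.MetaComplexity
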